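import Summits.HodgeConjecture.HodgeConjecture.Theorems.F0D9opRoad2
import HarnessLib
import HarnessLib.Audit.LibrarySuggestionsDenyListCorCM
import HarnessLib.Audit.LibrarySuggestionsDenyListCruxes

/-!
# F0_D9opRoad2 — ED. 9 = SHIM (K6 «MAIN + PARENT» row, LAST wave; rung-0 re-home, LEAD «M-72» (4)∕«M-140»∕«M-147d»; desk F0P6a-plan (g7) cand v9, written only on the LEAD heir՚s wave word)

Every declaration of the tree workfile `Lines/F0_D9opRoad2.lean` (ED. 8 «PWcore PAID», sha16 09709f616d3d0592, 1676 l., code-`sorry`-free, 0 sockets; 51 declarations)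
now lives, byte for byte and under the SAME namespace `Summit.HodgeConjecture.HodgeConjecture.Cruxes.HLiu418.F0D9opRoad2`, in the ★ chain
`Theorems/F0D9opRoad2Boundary.lean` → `Theorems/F0D9opRoad2Pen.lean` → `Theorems/F0D9opRoad2PenCongruence.lean` → `Theorems/F0D9opRoad2Descent.lean` → `Theorems/F0D9opRoad2Doors.lean` → `Theorems/F0D9opRoad2.lean` (LAST part = plain stem; each part imports the previous); this module keeps its name so that its tree importers
(socket `Lines/F0_AlbCm.lean` ED. 13 :337 `stub_D9op := …F0D9opRoad2.stub_D9op_holds` (FQN kept ★-side ⇒ resolves through the import; no alias needed)) and any by-name reader resolve unchanged through the import above.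
It declares ONLY the three by-name aliases of record below («M-150h» (2)): `stub_PWcore`, `stub_MODquot`, `stub_deg` — retired ★-side by the `dedup.landed` rule (cure (ii)), bodies = the landed ★ FQNs, statements byte-identical to the tree, 0 `sorry`.  ONE declaration of the tree edition is NOT in the ★ twin: `Summit.HodgeConjecture.HodgeConjecture.Cruxes.HLiu418.F0D9opRoad2.PenLemmas.finsum_map_geomReductionMap_map_eq_of_isOpenImmersion_specialFibre_at` was RETIRED by the (d1) `dedup.landed` pre-cure («M-142e»∕«M-142h» (ii): 0 code callers outside its own part ⇒ deleted, no alias; its one in-file caller reads the landed twin `Literature.AlgebraicGeometry.Motives.IntegralModel.finsum_map_geomReductionMap_map_eq_of_isOpenImmersion_specialFibre_at`), so nothing is aliased here either.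
CLOSURE-NAMES («M-146a» (2)): ∅ — members = tree rev-closure {`F0_AlbCm`} (MAIN ← `F0_D9opRoad2` ← `F0_AlbCm` ← ∅); with the MAIN ED. 11 and parent ED. 9 shims applied jointly no departed `Lines`-only name occurs in the member՚s code (desk leg `F0/P6/F0P6a-plan/g7/cn/closure_names.py`).
ORDER NOTE: written in ONE request with the parent∕MAIN shim and the socket `F0_AlbCm` as rider∕named importer, on the LEAD՚s word, after EVERY ★ part above is ACCEPTED (NO-CROSS-IMPORT: no environment may hold
a `Lines/` ORIGINAL together with its ★ twin); an importer smoke that reads «environment already contains …» before that request is BUILT is this order note, not a defect.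
Edition history stays in the line card `Lines/F0_D9opRoad2.md` and in git; future changes are ★-side proposals on the `Theorems/` files.
HC_CM is proved only modulo the printed citations (2 remaining named inputs: hLiu418 = stmt-HodgeConjecture-24832, h413 = stmt-HodgeConjecture-24833) until rung 0 closes; a re-home is count-neutral. (0 `sorry`, 0 socket, 3 alias declarations). -/

namespace Summit.HodgeConjecture.HodgeConjecture.Cruxes.HLiu418.F0D9opRoad2

set_option linter.dupNamespace false   -- as the tree workfile (`HodgeConjecture.HodgeConjecture` is the summit∕sub path, D-0017)

/-! ### «M-150h» (2) — NAMES OF RECORD RESTORED HUB-SIDE (by-name aliases; the ★ chain retired these three declarations by the `dedup.landed` rule, cure (ii);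
crux workfiles are outside the Theorems dedup lint). Docstrings = the tree ED. 8 docstrings verbatim; statements byte-identical to the tree; bodies = the landed ★ FQNs. -/

/-- **`stub_PWcore : RecordModuliPointwiseCoreCofinal` — PROVED BY NAME at ED. 8 «PWcore PAID» over the sub-line `Lines/F0_P6a_ModuliDatum.lean`** (was the ED. 6∕7 boundary (i) stub): the MODULI CORE (P6 wave 2; sub-line F0-P6a `F0_P6a_ModuliDatum` + organs of F0-P6b∕c∕d).
(print: Liu2021, Prop. D.8 (1)–(3) p. 135 + proof of Cor. D.9 p. 139) (print: Kottwitz1992, §5 pp. 389–392) (print: RapoportSmithlingZhang2020, §4.1 Thm. 4.1 p. 17)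
(print: Carayol1986Compositio, §10.3, Prop. p. 211) (print: Wedhorn2000CongruenceRelation, Thm. p. 2) -/
theorem stub_PWcore : RecordModuliPointwiseCoreCofinal :=
  Summit.HodgeConjecture.HodgeConjecture.Cruxes.HLiu418.F0P6aModuliDatum.pwcore_holds

/-- **`stub_MODquot : RecordTameLevelQuotientModel` — PROVED BY NAME (hand M-Q, A-p14 (g30) + A-p03 (g27)) at ED. 7 «MODquot PAID»**: the ED. 6 boundary (ii)
(the TAME LEVEL-QUOTIENT PACKAGING) is the DERIVED theorem `:= F0P6qTameLevelQuotient.quot_holds` over the imported sorry-free sub-line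
`Lines/F0_P6q_TameLevelQuotient.lean` (tree 095a9dabe50403a6; F0P6-ref1 BOX «P6q-1» GREEN 2026-09-01T13:54:15Z; P6 LEAD RULING «M-4» (4)); was `sorry` at ED. 6.
(print: SGA1, Exp. V Prop. 1.8, Cor. 1.5) (print: KatzMazur1985, A7.1) (print: MumfordAV1970, §7 Thm. p. 66) -/
theorem stub_MODquot : RecordTameLevelQuotientModel :=
  Summit.HodgeConjecture.HodgeConjecture.Cruxes.HLiu418.F0P6qTameLevelQuotient.quot_holds

/-- **`stub_deg : HeckeDegreeSplitPlace` — PROVED (ED. 5 desk v0.1)** by name from ★ p807687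
`Literature/NumberTheory/Automorphic/UnitaryGroupHeckeDegreeSplitPlace.lean` (clause (a): `natCard_orbit_heckeElementAt_one_uniformizer`,
under `IsHyperspecialAt` + the `glInt` clause) and ★ p808973 `Literature/NumberTheory/Automorphic/UnitaryGroupHeckeCentralElement.lean`
(clauses (b)(c): `coe_eq_of_mem_orbit_heckeElementAt_self`, `inv_mul_mul_heckeElementAt_self_mem` — `t_{w,2}` is central, hypothesis-free);
the term is F0P5a-p04 (g3)'s HOME cert `CERT-DEG-letter-holds.bypaste.F0P5a-p04g3.lean` 9e7776af (REF1 countersign 03:53:01Z) verbatim.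
(print: ShimuraIATAF1971, §3.2 proof of Lemma 3.22; DiamondShurman2005, §5.2; CartierCorvallis1979, §IV.1) -/
theorem stub_deg : HeckeDegreeSplitPlace :=
  Summit.HodgeConjecture.HodgeConjecture.Cruxes.HLiu418.F0P6aPointwiseFrobenius.deg_holds

end Summit.HodgeConjecture.HodgeConjecture.Cruxes.HLiu418.F0D9opRoad2
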